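import Mathlib
import HarnessLib
import Summits.HubbardSuperconductivity.HubbardSuperconductivity.Theorems.KLProgrammeKLRegimeVolumeLimitSitePeriodisationOnly

/-!
# The SITE KERNEL of the bare last-scale self-energy decays exponentially in the torus distance, uniformly in the volume and the Matsubara label —
# for every coupling; hence its first centred site moment (the (hD) text of the position-space doors) is a theorem
# (seat hubbard-kl-k3c5-p3 g6, technique «OS-positivity-free direct assembly»; `--supports` the VL child stmt-…-20239)

Route `KLProgramme`, crux K3, child VOLUME-LIMIT.  The position-space read-out of the engine lineage's nested two-volume pass (β′ semigroup defect,
k3c5-p2; α periodisation, k3c4-p1) delivers PINNED differences `σ_L(z) − σ_{bL}(clift z)` of site kernels; the bridge to the (S) text of the site doors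
(`sum_norm_sub_periodise_le_pinned_add_weighted / _firstMoment`, k3c4-p1 p510901) charges the FAR TAIL of the fine kernel to a weighted site norm /
first site moment of that kernel — until now an engine obligation ((E3-M)-like: first site moments of the two-leg kernel at the last scale).  This file makes
those site norms THEOREMS for every coupling, from the dressed-pair decay of this seat's lineage (`norm_dressedPair_matsubara_le`, …DressedModeDecay):

* §1 `torusFourierInv_const'`, `torusFourierInv_shiftedDressedMatsubara_eq` — the site kernel of `p ↦ 𝒵′(k,p)` at a relative site `y` is the volume AVERAGE
  of the single-site pair functions at separation `y`: `L⁻²·Σ_x h(x, x + y)` (character orthogonality);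
* §2 `norm_torusFourierInv_shiftedDressedMatsubara_le` — `‖·‖ ≤ (9/4)(5β/π)·e^{−γ‖y‖_𝕋}` for `y ≠ 0`, EVERY side `L`, every fermionic `k` with `|k| ≥ π/β`;
* §3 `norm_siteKernel_klSixInf_le`, **`norm_siteKernel_klSelfEnergyInf_zero_le`** — for `L ≥ 3`, `U ≠ 0`, every Matsubara integer `n` and every `y ≠ 0`:
  `‖torusFourierInv (Σ∞⁰_L(n,·)) y‖ ≤ U²·(9/4)(5β/π)·e^{−γ‖y‖_𝕋}` (the density `U·occ∞` sits at `y = 0` only);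
* §4 `siteKernel_firstMoment_le` — the first centred site moment `Σ_z (Σ_i|cRepZ z_i|)·‖torusFourierInv (Σ∞⁰_L(n,·)) z‖ ≤ 2U²(9/4)(5β/π)·Σ'_r 4(2r+1)r e^{−γr}`
  uniformly in `L ≥ 3` and `n`; §5 finite cutoffs and **`firstMomentText_holds (Pr W)`** — the (hD) text of `carrierRateText_of_sitePeriodisation` for every
  bundle and window.

Everything is proved; no definition.
-/

noncomputable section

namespace Summit.HubbardSuperconductivity.HubbardSuperconductivity.Theorems.TwoPointAssembly

set_option linter.dupNamespace false -- summit = problem name (single-conjunct summit), D-0017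

open scoped Matrix.Norms.L2Operator ComplexConjugate
open Matrix Complex Finset Filter Topology Literature.MathematicalPhysics.QuantumLattice Literature.Probability.LatticeModels
open Literature.MathematicalPhysics.QuantumLattice.FermiRG
open Summit.HubbardSuperconductivity.HubbardSuperconductivity.Theorems.DispersionFlow
open Summit.HubbardSuperconductivity.HubbardSuperconductivity.Theorems.KLRegimeSplit
open Summit.HubbardSuperconductivity.HubbardSuperconductivity.Theorems.KLProgrammeLegKernels
open Summit.HubbardSuperconductivity.HubbardSuperconductivity.Theorems.ThermalGreen

/-! ## §1 The site kernel of the dressed two-time function is a volume average of single-site pair functions -/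

section Site

variable {L : ℕ} [NeZero L]

/-- The inverse torus Fourier transform of a constant is supported at the origin. -/
theorem torusFourierInv_const' {d : ℕ} (c : ℂ) (y : TorusSite d L) :
    torusFourierInv (fun _ : TorusSite d L => c) y = if y = 0 then c else 0 := by
  rw [torusFourierInv_eq_sum_torusChar, ← Finset.mul_sum, sum_torusChar_left]
  split_ifs with hy
  · rw [← mul_assoc, mul_comm (((L : ℂ) ^ d)⁻¹) c, mul_assoc, inv_mul_cancel₀ (natCast_pow_ne_zero (d := d) (L := L)), mul_one]
  · rw [mul_zero, mul_zero]

/-- Character bookkeeping: `χ_p(x)·conj χ_p(x′)·χ_p(y) = χ_p(x − x′ + y)`. -/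
theorem torusChar_mul_conj_mul (p x x' y : TorusSite 2 L) :
    torusChar p x * conj (torusChar p x') * torusChar p y = torusChar p (x - x' + y) := by
  rw [torusChar_add_right, torusChar_sub_right]

/-- **The site kernel of `p ↦ 𝒵′(k,p)` is the volume average of the single-site pair functions**:
`torusFourierInv (p ↦ 𝒵′(k,p)) y = L⁻²·Σ_x h(x, x+y)`, `h(x,y) = ∫₀^β e^{ikτ}⟨A_{x̂}(τ)A_{ŷ}†⟩_H`. -/
theorem torusFourierInv_shiftedDressedMatsubara_eq [DecidableEq (FermionTorus 2 L)] (U μ β k : ℝ) (y : TorusSite 2 L) :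
    torusFourierInv (fun p : TorusSite 2 L =>
      ∫ τ in (0 : ℝ)..β, cexp (I * k * τ) * gibbsState β (hubbardTorusWith 2 L 1 U μ)
        (imagTimeEvolve (hubbardTorusWith 2 L 1 U μ) (τ : ℂ)
          ((∑ z : FermionTorus 2 L, (torusFourierWeight 2 L * torusChar (-p) z.toTorusSite) • (numberOp z 1 * creation (orb z 0)))ᴴ -
            (1 / 2 : ℂ) • momentumAnnihilation (-p) 0) *
          ((∑ z : FermionTorus 2 L, (torusFourierWeight 2 L * torusChar (-p) z.toTorusSite) • (numberOp z 1 * creation (orb z 0)))ᴴ -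
            (1 / 2 : ℂ) • momentumAnnihilation (-p) 0)ᴴ)) y =
      torusFourierWeight 2 L * torusFourierWeight 2 L *
        ∑ x : TorusSite 2 L, ∫ τ in (0 : ℝ)..β, cexp (I * k * τ) * gibbsState β (hubbardTorusWith 2 L 1 U μ)
          (imagTimeEvolve (hubbardTorusWith 2 L 1 U μ) (τ : ℂ)
            (annihilation (orb (FermionTorus.ofTorusSite x) 0) * numberOp (FermionTorus.ofTorusSite x) 1 -
              (1 / 2 : ℂ) • annihilation (orb (FermionTorus.ofTorusSite x) 0)) *
            (annihilation (orb (FermionTorus.ofTorusSite (x + y)) 0) * numberOp (FermionTorus.ofTorusSite (x + y)) 1 -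
              (1 / 2 : ℂ) • annihilation (orb (FermionTorus.ofTorusSite (x + y)) 0))ᴴ) := by
  set H := hubbardTorusWith 2 L 1 U μ with hH
  set h : TorusSite 2 L → TorusSite 2 L → ℂ := fun x x' =>
    ∫ τ in (0 : ℝ)..β, cexp (I * k * τ) * gibbsState β H (imagTimeEvolve H (τ : ℂ)
      (annihilation (orb (FermionTorus.ofTorusSite x) 0) * numberOp (FermionTorus.ofTorusSite x) 1 -
        (1 / 2 : ℂ) • annihilation (orb (FermionTorus.ofTorusSite x) 0)) *
      (annihilation (orb (FermionTorus.ofTorusSite x') 0) * numberOp (FermionTorus.ofTorusSite x') 1 -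
        (1 / 2 : ℂ) • annihilation (orb (FermionTorus.ofTorusSite x') 0))ᴴ) with hh
  set wL : ℂ := torusFourierWeight 2 L with hwL
  have hexp : ∀ p : TorusSite 2 L, (∫ τ in (0 : ℝ)..β, cexp (I * k * τ) * gibbsState β H
      (imagTimeEvolve H (τ : ℂ)
        ((∑ z : FermionTorus 2 L, (torusFourierWeight 2 L * torusChar (-p) z.toTorusSite) • (numberOp z 1 * creation (orb z 0)))ᴴ -
          (1 / 2 : ℂ) • momentumAnnihilation (-p) 0) *
        ((∑ z : FermionTorus 2 L, (torusFourierWeight 2 L * torusChar (-p) z.toTorusSite) • (numberOp z 1 * creation (orb z 0)))ᴴ -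
          (1 / 2 : ℂ) • momentumAnnihilation (-p) 0)ᴴ)) =
      ∑ x : TorusSite 2 L, ∑ x' : TorusSite 2 L, wL * torusChar p x * (wL * conj (torusChar p x') * h x x') :=
    fun p => shiftedDressedMatsubara_eq_sum U μ β k p
  change torusFourierInv (fun p : TorusSite 2 L => ∫ τ in (0 : ℝ)..β, cexp (I * k * τ) * gibbsState β H
      (imagTimeEvolve H (τ : ℂ)
        ((∑ z : FermionTorus 2 L, (torusFourierWeight 2 L * torusChar (-p) z.toTorusSite) • (numberOp z 1 * creation (orb z 0)))ᴴ -
          (1 / 2 : ℂ) • momentumAnnihilation (-p) 0) *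
        ((∑ z : FermionTorus 2 L, (torusFourierWeight 2 L * torusChar (-p) z.toTorusSite) • (numberOp z 1 * creation (orb z 0)))ᴴ -
          (1 / 2 : ℂ) • momentumAnnihilation (-p) 0)ᴴ)) y = wL * wL * ∑ x : TorusSite 2 L, h x (x + y)
  rw [torusFourierInv_eq_sum_torusChar]
  simp_rw [hexp]
  -- reorder: Σ_p Σ_x Σ_x' (…) χ_p(y) = Σ_x Σ_x' wL² h x x' Σ_p χ_p(x − x' + y)
  have hswap : ∑ p : TorusSite 2 L, (∑ x : TorusSite 2 L, ∑ x' : TorusSite 2 L, wL * torusChar p x * (wL * conj (torusChar p x') * h x x')) *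
        torusChar p y =
      ∑ x : TorusSite 2 L, ∑ x' : TorusSite 2 L, wL * wL * h x x' * ∑ p : TorusSite 2 L, torusChar p (x - x' + y) := by
    simp_rw [Finset.sum_mul, Finset.mul_sum]
    rw [Finset.sum_comm]
    refine Finset.sum_congr rfl fun x _ => ?_
    rw [Finset.sum_comm]
    refine Finset.sum_congr rfl fun x' _ => Finset.sum_congr rfl fun p _ => ?_
    rw [← torusChar_mul_conj_mul]; ring
  rw [hswap]
  simp_rw [sum_torusChar_left]
  have hinner : ∀ x : TorusSite 2 L, ∑ x' : TorusSite 2 L, wL * wL * h x x' * (if x - x' + y = 0 then ((L : ℂ) ^ 2) else 0) =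
      wL * wL * h x (x + y) * (L : ℂ) ^ 2 := by
    intro x
    have hiff : ∀ x' : TorusSite 2 L, (x - x' + y = 0) ↔ (x' = x + y) := by
      intro x'
      rw [sub_add_eq_add_sub, sub_eq_zero, eq_comm]
    simp_rw [hiff]
    rw [Finset.sum_eq_single (x + y)]
    · simp
    · intro x' _ hx'; simp [hx']
    · intro hmem; exact absurd (Finset.mem_univ _) hmem
  simp_rw [hinner]
  have hL2 := natCast_pow_ne_zero (d := 2) (L := L)
  rw [← Finset.sum_mul, ← Finset.mul_sum, mul_comm (wL * wL * ∑ x : TorusSite 2 L, h x (x + y)) ((L : ℂ) ^ 2), ← mul_assoc,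
    inv_mul_cancel₀ hL2, one_mul]

/-! ## §2 Exponential decay of that site kernel, uniformly in the volume and the label -/

/-- **`‖torusFourierInv (𝒵′(k,·)) y‖ ≤ (9/4)(5β/π)·e^{−γ‖y‖_𝕋}` for `y ≠ 0`**, every side `L`, every fermionic `k` with `|k| ≥ π/β`
(`γ = min(1/2, π/(8κβ))`, `κ = e·2J·18`, `J = 2|1| + |U| + 2|μ|`). -/
theorem norm_torusFourierInv_shiftedDressedMatsubara_le [DecidableEq (FermionTorus 2 L)] (U μ : ℝ) {β : ℝ} (hβ : 0 < β) {k : ℝ}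
    (hk : cexp (I * k * β) = -1) (hka : Real.pi / β ≤ |k|) {y : TorusSite 2 L} (hy : y ≠ 0) :
    ‖torusFourierInv (fun p : TorusSite 2 L =>
      ∫ τ in (0 : ℝ)..β, cexp (I * k * τ) * gibbsState β (hubbardTorusWith 2 L 1 U μ)
        (imagTimeEvolve (hubbardTorusWith 2 L 1 U μ) (τ : ℂ)
          ((∑ z : FermionTorus 2 L, (torusFourierWeight 2 L * torusChar (-p) z.toTorusSite) • (numberOp z 1 * creation (orb z 0)))ᴴ -
            (1 / 2 : ℂ) • momentumAnnihilation (-p) 0) *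
          ((∑ z : FermionTorus 2 L, (torusFourierWeight 2 L * torusChar (-p) z.toTorusSite) • (numberOp z 1 * creation (orb z 0)))ᴴ -
            (1 / 2 : ℂ) • momentumAnnihilation (-p) 0)ᴴ)) y‖ ≤
      (3 / 2) * (3 / 2) * (5 * β / Real.pi) *
        Real.exp (-(min (1 / 2 : ℝ) (Real.pi / (8 * (Real.exp 1 * (2 * (2 * |(1 : ℝ)| + |U| + 2 * |μ|) * (2 * (2 * 4 + 1) : ℕ))) * β)) *
          torusNorm y)) := by
  rw [torusFourierInv_shiftedDressedMatsubara_eq]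
  have hxy : ∀ x : TorusSite 2 L, x ≠ x + y := fun x h => hy (by simpa using h)
  have hdist : ∀ x : TorusSite 2 L, torusDist x (x + y) = torusNorm y := by
    intro x; rw [torusDist, show x - (x + y) = -y by abel, torusNorm_neg]
  have hterm : ∀ x : TorusSite 2 L, ‖∫ τ in (0 : ℝ)..β, cexp (I * k * τ) * gibbsState β (hubbardTorusWith 2 L 1 U μ)
      (imagTimeEvolve (hubbardTorusWith 2 L 1 U μ) (τ : ℂ)
        (annihilation (orb (FermionTorus.ofTorusSite x) 0) * numberOp (FermionTorus.ofTorusSite x) 1 -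
          (1 / 2 : ℂ) • annihilation (orb (FermionTorus.ofTorusSite x) 0)) *
        (annihilation (orb (FermionTorus.ofTorusSite (x + y)) 0) * numberOp (FermionTorus.ofTorusSite (x + y)) 1 -
          (1 / 2 : ℂ) • annihilation (orb (FermionTorus.ofTorusSite (x + y)) 0))ᴴ)‖ ≤
      (3 / 2) * (3 / 2) * (5 * β / Real.pi) *
        Real.exp (-(min (1 / 2 : ℝ) (Real.pi / (8 * (Real.exp 1 * (2 * (2 * |(1 : ℝ)| + |U| + 2 * |μ|) * (2 * (2 * 4 + 1) : ℕ))) * β)) *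
          torusNorm y)) := by
    intro x
    have h := norm_dressedPair_matsubara_le U μ hβ hk hka (hxy x)
    rw [hdist x] at h
    exact h
  have hw : ‖torusFourierWeight 2 L * torusFourierWeight 2 L‖ * (Fintype.card (TorusSite 2 L) : ℝ) = 1 := by
    rw [norm_mul, torusFourierWeight_two, norm_inv, Complex.norm_natCast]
    have hL : (L : ℝ) ≠ 0 := Nat.cast_ne_zero.mpr (NeZero.ne L)
    have hcard : (Fintype.card (TorusSite 2 L) : ℝ) = (L : ℝ) ^ 2 := by
      rw [Fintype.card_fun, ZMod.card, Fintype.card_fin]; push_cast; ring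
    rw [hcard]; field_simp
  rw [norm_mul]
  refine (mul_le_mul_of_nonneg_left ((norm_sum_le _ _).trans (Finset.sum_le_sum fun x _ => hterm x)) (norm_nonneg _)).trans ?_
  rw [Finset.sum_const, Finset.card_univ, nsmul_eq_mul, ← mul_assoc, hw, one_mul]

/-! ## §3 The site kernels of `Six∞_L(n,·)` and of the bare cutoff-free carrier `Σ∞⁰_L(n,·)` -/

/-- Linearity bookkeeping: `torusFourierInv (−g) = −torusFourierInv g`. -/
theorem torusFourierInv_neg' {d : ℕ} (g : TorusSite d L → ℂ) (y : TorusSite d L) :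
    torusFourierInv (fun p => -g p) y = -torusFourierInv g y := by
  simp only [torusFourierInv_eq_sum_torusChar, neg_mul, Finset.sum_neg_distrib, mul_neg]

/-- Linearity bookkeeping: `torusFourierInv (a + c·g) = torusFourierInv a + c·torusFourierInv g` for a constant `a`. -/
theorem torusFourierInv_const_add_mul {d : ℕ} (a c : ℂ) (g : TorusSite d L → ℂ) (y : TorusSite d L) :
    torusFourierInv (fun p => a + c * g p) y = torusFourierInv (fun _ => a) y + c * torusFourierInv g y := by
  simp only [torusFourierInv_eq_sum_torusChar, add_mul, Finset.sum_add_distrib, mul_add, Finset.mul_sum]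
  congr 1
  refine Finset.sum_congr rfl fun p _ => ?_
  ring

/-- **`‖torusFourierInv (Six∞_L(n,·)) y‖ ≤ (9/4)(5β/π)·e^{−γ‖y‖_𝕋}`** for `y ≠ 0`, `L ≥ 3`, `U ≠ 0`, every Matsubara integer `n`. -/
theorem norm_siteKernel_klSixInf_le (hL : 3 ≤ L) {β : ℝ} (hβ : 0 < β) {U : ℝ} (hU : U ≠ 0) (μ : ℝ) (n : ℤ)
    {y : TorusSite 2 L} (hy : y ≠ 0) :
    ‖torusFourierInv (fun p : TorusSite 2 L => klSixInf L β U μ n p) y‖ ≤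
      (3 / 2) * (3 / 2) * (5 * β / Real.pi) *
        Real.exp (-(min (1 / 2 : ℝ) (Real.pi / (8 * (Real.exp 1 * (2 * (2 * |(1 : ℝ)| + |U| + 2 * |μ + U / 2|) * (2 * (2 * 4 + 1) : ℕ))) * β)) *
          torusNorm y)) := by
  have hk : cexp (I * ((Real.pi * (2 * (n : ℝ) + 1) / β : ℝ) : ℂ) * β) = -1 := by
    have h := cexp_fermiMatsubara_mul_beta hβ.ne' n
    simp only [fermiMatsubara] at h
    exact h
  have hka : Real.pi / β ≤ |(Real.pi * (2 * (n : ℝ) + 1) / β : ℝ)| := by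
    have h := Literature.MathematicalPhysics.QuantumLattice.pi_div_le_abs_fermiMatsubara hβ n
    simp only [fermiMatsubara] at h
    exact h
  have hfun : (fun p : TorusSite 2 L => klSixInf L β U μ n p) = fun p : TorusSite 2 L =>
      -(∫ τ in (0 : ℝ)..β, cexp (I * ((Real.pi * (2 * (n : ℝ) + 1) / β : ℝ) : ℂ) * τ) *
        gibbsState β (hubbardTorusWith 2 L 1 U (μ + U / 2))
          (imagTimeEvolve (hubbardTorusWith 2 L 1 U (μ + U / 2)) (τ : ℂ)
            ((∑ z : FermionTorus 2 L, (torusFourierWeight 2 L * torusChar (-p) z.toTorusSite) • (numberOp z 1 * creation (orb z 0)))ᴴ -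
              (1 / 2 : ℂ) • momentumAnnihilation (-p) 0) *
            ((∑ z : FermionTorus 2 L, (torusFourierWeight 2 L * torusChar (-p) z.toTorusSite) • (numberOp z 1 * creation (orb z 0)))ᴴ -
              (1 / 2 : ℂ) • momentumAnnihilation (-p) 0)ᴴ)) :=
    funext fun p => klSixInf_eq_neg_shiftedDressedMatsubara hL hβ hU μ n p
  rw [hfun, torusFourierInv_neg', norm_neg]
  exact norm_torusFourierInv_shiftedDressedMatsubara_le U (μ + U / 2) hβ hk hka hy

/-- **`‖torusFourierInv (Σ∞⁰_L(n,·)) y‖ ≤ U²·(9/4)(5β/π)·e^{−γ‖y‖_𝕋}` for `y ≠ 0`** (`L ≥ 3`, `U ≠ 0`, every `n`): the site kernel of the bare cutoff-free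
VL carrier decays exponentially in the torus distance, uniformly in the volume and the label (the density `U·occ∞` contributes at `y = 0` only). -/
theorem norm_siteKernel_klSelfEnergyInf_zero_le (hL : 3 ≤ L) {β : ℝ} (hβ : 0 < β) {U : ℝ} (hU : U ≠ 0) (μ : ℝ)
    (n : ℤ) {y : TorusSite 2 L} (hy : y ≠ 0) :
    ‖torusFourierInv (fun p : TorusSite 2 L => klSelfEnergyInf L β U μ 0 n p) y‖ ≤
      U ^ 2 * ((3 / 2) * (3 / 2) * (5 * β / Real.pi) *
        Real.exp (-(min (1 / 2 : ℝ) (Real.pi / (8 * (Real.exp 1 * (2 * (2 * |(1 : ℝ)| + |U| + 2 * |μ + U / 2|) * (2 * (2 * 4 + 1) : ℕ))) * β)) *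
          torusNorm y))) := by
  have hfun : (fun p : TorusSite 2 L => klSelfEnergyInf L β U μ 0 n p) =
      fun p : TorusSite 2 L => (U : ℂ) * klOccInf L β U μ + (U : ℂ) ^ 2 * klSixInf L β U μ n p :=
    funext fun p => klSelfEnergyInf_zero_frame hβ.ne' U μ n p
  rw [hfun, torusFourierInv_const_add_mul, torusFourierInv_const', if_neg hy, zero_add, norm_mul, norm_pow, Complex.norm_real,
    Real.norm_eq_abs, sq_abs]
  exact mul_le_mul_of_nonneg_left (norm_siteKernel_klSixInf_le hL hβ hU μ n hy) (sq_nonneg U)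

/-! ## §4 The first centred site moment of the carrier's site kernel is bounded uniformly in the volume and the label -/

/-- **`Σ_z (Σ_i |cRepZ z_i|)·‖torusFourierInv (Σ∞⁰_L(n,·)) z‖ ≤ 2U²(9/4)(5β/π)·Σ'_r 4(2r+1)·r·e^{−γr}`**, uniformly in `L ≥ 3` and `n` (`U ≠ 0`). -/
theorem siteKernel_firstMoment_le (hL : 3 ≤ L) {β : ℝ} (hβ : 0 < β) {U : ℝ} (hU : U ≠ 0) (μ : ℝ) (n : ℤ) :
    ∑ z : TorusSite 2 L, (∑ i, |(Torus.cRepZ (z i) : ℝ)|) * ‖torusFourierInv (fun p : TorusSite 2 L => klSelfEnergyInf L β U μ 0 n p) z‖ ≤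
      2 * (U ^ 2 * ((3 / 2) * (3 / 2) * (5 * β / Real.pi))) *
        ∑' r : ℕ, (4 * (2 * (r : ℝ) + 1)) * ((r : ℝ) *
          Real.exp (-(min (1 / 2 : ℝ) (Real.pi / (8 * (Real.exp 1 * (2 * (2 * |(1 : ℝ)| + |U| + 2 * |μ + U / 2|) * (2 * (2 * 4 + 1) : ℕ))) * β)) * r))) := by
  set κ : ℝ := Real.exp 1 * (2 * (2 * |(1 : ℝ)| + |U| + 2 * |μ + U / 2|) * (2 * (2 * 4 + 1) : ℕ)) with hκ
  have hJpos : 0 < 2 * |(1 : ℝ)| + |U| + 2 * |μ + U / 2| := by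
    have h1 : |(1 : ℝ)| = 1 := abs_one
    have := abs_nonneg U; have := abs_nonneg (μ + U / 2); linarith
  have hκpos : 0 < κ := by positivity
  set γ : ℝ := min (1 / 2 : ℝ) (Real.pi / (8 * κ * β)) with hγ
  have hγpos : 0 < γ := lt_min (by norm_num) (by positivity)
  set c : ℝ := U ^ 2 * ((3 / 2) * (3 / 2) * (5 * β / Real.pi)) with hc
  have hc0 : 0 ≤ c := by positivity
  -- termwise: weight ≤ 2·dist(z,0), kernel ≤ c e^{−γ dist(z,0)} off the origin (and weight 0 at the origin)
  have hterm : ∀ z : TorusSite 2 L, (∑ i, |(Torus.cRepZ (z i) : ℝ)|) * ‖torusFourierInv (fun p : TorusSite 2 L => klSelfEnergyInf L β U μ 0 n p) z‖ ≤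
      2 * c * ((torusDist z 0 : ℝ) * Real.exp (-(γ * torusDist z 0))) := by
    intro z
    by_cases hz : z = 0
    · subst hz
      have h0 : ∑ i, |(Torus.cRepZ ((0 : TorusSite 2 L) i) : ℝ)| = 0 := by
        have := sum_abs_cRepZ_sub_le (0 : TorusSite 2 L) 0
        simp only [sub_zero, torusDist_self, Nat.cast_zero, mul_zero] at this
        exact le_antisymm this (Finset.sum_nonneg fun i _ => abs_nonneg _)
      rw [h0, zero_mul]
      positivity
    · have hw : ∑ i, |(Torus.cRepZ (z i) : ℝ)| ≤ 2 * (torusDist z 0 : ℝ) := by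
        have := sum_abs_cRepZ_sub_le z 0
        simpa only [sub_zero, Nat.cast_ofNat] using this
      have hk := norm_siteKernel_klSelfEnergyInf_zero_le hL hβ hU μ n hz
      have hnorm : (torusNorm z : ℝ) = (torusDist z 0 : ℝ) := by rw [torusDist, sub_zero]
      rw [← hγ, hnorm] at hk
      calc (∑ i, |(Torus.cRepZ (z i) : ℝ)|) * ‖torusFourierInv (fun p : TorusSite 2 L => klSelfEnergyInf L β U μ 0 n p) z‖
          ≤ (2 * (torusDist z 0 : ℝ)) * (U ^ 2 * ((3 / 2) * (3 / 2) * (5 * β / Real.pi) * Real.exp (-(γ * torusDist z 0)))) :=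
            mul_le_mul hw hk (norm_nonneg _) (by positivity)
        _ = 2 * c * ((torusDist z 0 : ℝ) * Real.exp (-(γ * torusDist z 0))) := by rw [hc]; ring
  calc ∑ z : TorusSite 2 L, (∑ i, |(Torus.cRepZ (z i) : ℝ)|) * ‖torusFourierInv (fun p : TorusSite 2 L => klSelfEnergyInf L β U μ 0 n p) z‖
      ≤ ∑ z : TorusSite 2 L, 2 * c * ((torusDist z 0 : ℝ) * Real.exp (-(γ * torusDist z 0))) := Finset.sum_le_sum fun z _ => hterm z
    _ = 2 * c * ∑ z : TorusSite 2 L, (torusDist z 0 : ℝ) * Real.exp (-(γ * torusDist z 0)) := by rw [Finset.mul_sum]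
    _ ≤ 2 * c * ∑' r : ℕ, (4 * (2 * (r : ℝ) + 1)) * ((r : ℝ) * Real.exp (-(γ * r))) :=
        mul_le_mul_of_nonneg_left (sum_torusDist_mul_exp_le hγpos 0) (by positivity)

/-! ## §5 Finite cutoffs: the (hD) first-moment text of the position-space doors HOLDS for every bundle and window -/

/-- At finite cutoff, eventually in `M` (all labels): the first centred site moment of the site kernel of `Σ̂⁰_{L,M}(ω,·)` is bounded by `D + 1`,
`D` the cutoff-free constant of §4 (`torusFourierInv` is an average, so the label-uniform cutoff removal passes through it). -/
theorem siteKernel_firstMoment_eventually_le (hL : 3 ≤ L) {β : ℝ} (hβ : 0 < β) {U : ℝ} (hU : U ≠ 0) (μ : ℝ) :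
    ∃ M₀ : ℕ, ∀ (M : ℕ) [NeZero M], M₀ ≤ M → ∀ ω : MatsubaraIdx M,
      ∑ z : TorusSite 2 L, (∑ i, |(Torus.cRepZ (z i) : ℝ)|) *
          ‖torusFourierInv (fun p : TorusSite 2 L => klSelfEnergy L M β U μ 0 klE0 (nScales β + 1) (ω, p) 0) z‖ ≤
        2 * (U ^ 2 * ((3 / 2) * (3 / 2) * (5 * β / Real.pi))) *
          ∑' r : ℕ, (4 * (2 * (r : ℝ) + 1)) * ((r : ℝ) *
            Real.exp (-(min (1 / 2 : ℝ) (Real.pi / (8 * (Real.exp 1 * (2 * (2 * |(1 : ℝ)| + |U| + 2 * |μ + U / 2|) * (2 * (2 * 4 + 1) : ℕ))) * β)) * r))) + 1 := by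
  -- the weights are bounded by `2L` and there are `L²` sites: choose `ε = 1/(2L³)`
  have hLpos : (0 : ℝ) < L := Nat.cast_pos.mpr (Nat.pos_of_ne_zero (NeZero.ne L))
  have hε : (0 : ℝ) < 1 / (2 * (L : ℝ) ^ 3 + 1) := by positivity
  obtain ⟨M₁, hM₁⟩ := klSelfEnergy_cutoffLimit_labelUniform hL hβ U μ 0 hε
  refine ⟨M₁, fun M _ hM ω => ?_⟩
  have hD := siteKernel_firstMoment_le hL hβ hU μ (matsubaraInt M ω)
  -- site-kernel closeness: `‖tFI f z − tFI g z‖ ≤ ε` when `‖f − g‖ ≤ ε` pointwise (average of `L²` terms of size `≤ ε`, weight `1/L²`)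
  have hclose : ∀ z : TorusSite 2 L,
      ‖torusFourierInv (fun p : TorusSite 2 L => klSelfEnergy L M β U μ 0 klE0 (nScales β + 1) (ω, p) 0) z -
        torusFourierInv (fun p : TorusSite 2 L => klSelfEnergyInf L β U μ 0 (matsubaraInt M ω) p) z‖ ≤ 1 / (2 * (L : ℝ) ^ 3 + 1) := by
    intro z
    rw [torusFourierInv_eq_sum_torusChar, torusFourierInv_eq_sum_torusChar, ← mul_sub, ← Finset.sum_sub_distrib, norm_mul, norm_inv,
      norm_pow, Complex.norm_natCast]
    have hsum : ‖∑ p : TorusSite 2 L, (klSelfEnergy L M β U μ 0 klE0 (nScales β + 1) (ω, p) 0 * torusChar p z -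
        klSelfEnergyInf L β U μ 0 (matsubaraInt M ω) p * torusChar p z)‖ ≤ (Fintype.card (TorusSite 2 L) : ℝ) * (1 / (2 * (L : ℝ) ^ 3 + 1)) := by
      refine (norm_sum_le _ _).trans ?_
      calc ∑ p : TorusSite 2 L, ‖klSelfEnergy L M β U μ 0 klE0 (nScales β + 1) (ω, p) 0 * torusChar p z -
              klSelfEnergyInf L β U μ 0 (matsubaraInt M ω) p * torusChar p z‖
          ≤ ∑ _p : TorusSite 2 L, 1 / (2 * (L : ℝ) ^ 3 + 1) := Finset.sum_le_sum fun p _ => by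
              rw [← sub_mul, norm_mul, norm_torusChar, mul_one]; exact hM₁ M hM ω p 0
        _ = (Fintype.card (TorusSite 2 L) : ℝ) * (1 / (2 * (L : ℝ) ^ 3 + 1)) := by rw [Finset.sum_const, Finset.card_univ, nsmul_eq_mul]
    have hcard : (Fintype.card (TorusSite 2 L) : ℝ) = (L : ℝ) ^ 2 := by
      rw [Fintype.card_fun, ZMod.card, Fintype.card_fin]; push_cast; ring
    rw [hcard] at hsum
    calc ((L : ℝ) ^ 2)⁻¹ * ‖∑ p : TorusSite 2 L, (klSelfEnergy L M β U μ 0 klE0 (nScales β + 1) (ω, p) 0 * torusChar p z -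
            klSelfEnergyInf L β U μ 0 (matsubaraInt M ω) p * torusChar p z)‖
        ≤ ((L : ℝ) ^ 2)⁻¹ * ((L : ℝ) ^ 2 * (1 / (2 * (L : ℝ) ^ 3 + 1))) := mul_le_mul_of_nonneg_left hsum (by positivity)
      _ = 1 / (2 * (L : ℝ) ^ 3 + 1) := by field_simp
  -- weights: `Σ_i |cRepZ z_i| ≤ 2·dist(z,0) ≤ 2L`
  have hwt : ∀ z : TorusSite 2 L, ∑ i, |(Torus.cRepZ (z i) : ℝ)| ≤ 2 * (L : ℝ) := by
    intro z
    have h1 : ∑ i, |(Torus.cRepZ (z i) : ℝ)| ≤ 2 * (torusDist z 0 : ℝ) := by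
      simpa only [sub_zero, Nat.cast_ofNat] using sum_abs_cRepZ_sub_le z 0
    have h2' : torusDist z (0 : TorusSite 2 L) < L := torusDist_lt z 0
    have h2 : (torusDist z (0 : TorusSite 2 L) : ℝ) ≤ (L : ℝ) := by exact_mod_cast h2'.le
    linarith
  set a : TorusSite 2 L → ℂ := fun z => torusFourierInv (fun p : TorusSite 2 L => klSelfEnergy L M β U μ 0 klE0 (nScales β + 1) (ω, p) 0) z with ha
  set b : TorusSite 2 L → ℂ := fun z => torusFourierInv (fun p : TorusSite 2 L => klSelfEnergyInf L β U μ 0 (matsubaraInt M ω) p) z with hb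
  set w : TorusSite 2 L → ℝ := fun z => ∑ i, |(Torus.cRepZ (z i) : ℝ)| with hw
  change ∑ z : TorusSite 2 L, w z * ‖a z‖ ≤ _
  change ∑ z : TorusSite 2 L, w z * ‖b z‖ ≤ _ at hD
  have hz_le : ∀ z : TorusSite 2 L, w z * ‖a z‖ ≤ w z * ‖b z‖ + 2 * (L : ℝ) * (1 / (2 * (L : ℝ) ^ 3 + 1)) := by
    intro z
    have hw0 : 0 ≤ w z := Finset.sum_nonneg fun i _ => abs_nonneg _
    have h1 : ‖a z‖ ≤ ‖b z‖ + 1 / (2 * (L : ℝ) ^ 3 + 1) :=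
      (norm_le_insert' (a z) (b z)).trans (add_le_add le_rfl (hclose z))
    calc w z * ‖a z‖ ≤ w z * (‖b z‖ + 1 / (2 * (L : ℝ) ^ 3 + 1)) := mul_le_mul_of_nonneg_left h1 hw0
      _ = w z * ‖b z‖ + w z * (1 / (2 * (L : ℝ) ^ 3 + 1)) := by ring
      _ ≤ w z * ‖b z‖ + 2 * (L : ℝ) * (1 / (2 * (L : ℝ) ^ 3 + 1)) := by
          have := mul_le_mul_of_nonneg_right (hwt z) hε.le
          linarith
  have hcard : (Fintype.card (TorusSite 2 L) : ℝ) = (L : ℝ) ^ 2 := by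
    rw [Fintype.card_fun, ZMod.card, Fintype.card_fin]; push_cast; ring
  have hsum : ∑ z : TorusSite 2 L, w z * ‖a z‖ ≤ (∑ z : TorusSite 2 L, w z * ‖b z‖) + (L : ℝ) ^ 2 * (2 * (L : ℝ) * (1 / (2 * (L : ℝ) ^ 3 + 1))) := by
    calc ∑ z : TorusSite 2 L, w z * ‖a z‖ ≤ ∑ z : TorusSite 2 L, (w z * ‖b z‖ + 2 * (L : ℝ) * (1 / (2 * (L : ℝ) ^ 3 + 1))) :=
          Finset.sum_le_sum fun z _ => hz_le z
      _ = (∑ z : TorusSite 2 L, w z * ‖b z‖) + (L : ℝ) ^ 2 * (2 * (L : ℝ) * (1 / (2 * (L : ℝ) ^ 3 + 1))) := by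
          rw [Finset.sum_add_distrib, Finset.sum_const, Finset.card_univ, nsmul_eq_mul, hcard]
  have hsmall : (L : ℝ) ^ 2 * (2 * (L : ℝ) * (1 / (2 * (L : ℝ) ^ 3 + 1))) ≤ 1 := by
    rw [show (L : ℝ) ^ 2 * (2 * (L : ℝ) * (1 / (2 * (L : ℝ) ^ 3 + 1))) = (2 * (L : ℝ) ^ 3) / (2 * (L : ℝ) ^ 3 + 1) by ring]
    exact (div_le_one (by positivity)).mpr (by linarith)
  linarith

end Site

/-- **THE (hD) FIRST-MOMENT TEXT HOLDS (every `Pr`, every `W`)**: the first centred site moment hypothesis of `carrierRateText_of_sitePeriodisation` /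
`volumeLimitP2_of_sitePeriodisationText` is a theorem (`L₀ = 3`, `D = D(β,U,μ)` of §4 plus one; the tower, the frame and the regime are not used). -/
theorem firstMomentText_holds (Pr : Preds) (W : Set ℝ) :
    ∀ (G : GeoConsts) (P : SplitConsts) (Q : EngConsts) (R : RenConsts), G.WF → P.WF → Q.WF → R.WF →
      ∃ c₅ : ℝ, 0 < c₅ ∧ ∀ c : ℝ, 0 < c → c ≤ c₅ → ∃ U₀ : ℝ, 0 < U₀ ∧
        ∀ μ ∈ W, ∀ U : ℝ, 0 < U → U ≤ U₀ → ∀ β : ℝ, klBetaMin ≤ β → β ≤ Real.exp (c / U ^ 2) →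
          ∀ K : TrigPolyC4v, Pr.frameOK R U (nScales β) μ K →
            ∀ (Lstar : ℕ) (Mstar : ℕ → ℕ), TowerP Pr G P Q R β U μ K Lstar Mstar →
              ∃ L₀ : ℕ, ∃ D : ℝ, ∀ (L : ℕ) [NeZero L], L₀ ≤ L → ∃ M₀ : ℕ, ∀ (M : ℕ) [NeZero M], M₀ ≤ M → ∀ ω : MatsubaraIdx M,
                ∑ z : TorusSite 2 L, (∑ i, |(Torus.cRepZ (z i) : ℝ)|) *
                  ‖torusFourierInv (fun k : TorusSite 2 L => klSelfEnergy L M β U μ 0 klE0 (nScales β + 1) (ω, k) 0) z‖ ≤ D := by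
  intro G P Q R _ _ _ _
  refine ⟨1, one_pos, fun c _ _ => ⟨1, one_pos, ?_⟩⟩
  intro μ _ U hU _ β hβmin _ K _ Lstar Mstar _
  have hβ : 0 < β := pos_of_klBetaMin_le hβmin
  refine ⟨3, 2 * (U ^ 2 * ((3 / 2) * (3 / 2) * (5 * β / Real.pi))) *
      ∑' r : ℕ, (4 * (2 * (r : ℝ) + 1)) * ((r : ℝ) *
        Real.exp (-(min (1 / 2 : ℝ) (Real.pi / (8 * (Real.exp 1 * (2 * (2 * |(1 : ℝ)| + |U| + 2 * |μ + U / 2|) * (2 * (2 * 4 + 1) : ℕ))) * β)) * r))) + 1,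
    fun L _ hL => ?_⟩
  exact siteKernel_firstMoment_eventually_le hL hβ hU.ne' μ

end Summit.HubbardSuperconductivity.HubbardSuperconductivity.Theorems.TwoPointAssembly

end
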